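import Literature.Probability.Percolation.NearCriticalCorrelationLength
import Literature.Probability.Percolation.NearCriticalScaling
import HarnessLib

/-!
# The finite-cluster mean size of `𝕋` as a sum of truncated connectivities; two-point bound by two arms

Topic `Literature/Probability/Percolation`; family `crit-perc`, statement **crit-perc.S16**, named fact
`Literature.Probability.Percolation.triMeanClusterSize_exponent` (`χ^f(p) = |p - 1/2|^{-43/18 + o(1)}`,
Smirnov–Werner 2001, §2, Thm. 1 (ii); Nolin 2008, §7.5). Proofs only (no named fact). Second brick
of the bottom-up reduction of that fact to the tree's near-critical named facts, after the assembly
`MeanClusterSizeScaling.lean`: the two elementary inputs of Nolin's proof of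
`χ(p) ≍ L(p)² π₁²(L(p))` (*Electron. J. Probab.* **13** (2008), §7.5, Lemmas 41–42 and Prop. 43 of
arXiv 0711.4948) that concern the mean size itself,

* **`χ^f(p) = Σ_x P_p(0 ↔ x, |C(0)| < ∞)`** (Nolin, proof of Lemma 42: the left-hand side of
  (7.28) at `t = 0` *is* `χ(p) = E_p[|C(0)|; |C(0)| < ∞]`, Prop. 43; Grimmett 1999, (1.15) and
  §6.5), here `triMeanClusterSize_eq_tsum`: `triMeanClusterSize p = Σ' y, P_p(triFinConn 0 y)` in
  `ℝ≥0∞` (Tonelli), with the tree's truncated connectivity event `triFinConn`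
  (`NearCriticalCorrelationLength.lean`);
* **two disjoint boxes** (Nolin, proof of Lemma 41, item 2, display (7.27): "take the two boxes
  `S_{2^{j-2}}(0)` and `S_{2^{j-2}}(x)`: since they are disjoint,
  `P̂(0 ↔ x) ≤ P̂(0 ↔ ∂S_{2^{j-2}}(0)) P̂(x ↔ ∂S_{2^{j-2}}(x))`"), here with hexagons:
  `real_triConn_le_sq`: if `2m < |x|_𝕋` then `P_p(0 ↔ x) ≤ P_p(0 ↔ ∂Λ_m)²`, by the independence of
  events determined by the disjoint balls `Λ_m` and `x + Λ_m` (`sitePercolation_real_inter_of_disjoint`)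
  and the translation invariance of `P_p` (`sitePercolation_real_preimage_relabel`).

Also recorded: measurability of `{0 ↔ x}`, `{|C(0)| = ∞}` and `triFinConn 0 x` on `𝕋`, and the
inclusion `{0 ↔ x} ⊆ {0 ↔ ∂Λ_m}` for `m ≤ |x|_𝕋` (first exit, `mem_triOneArm_of_pathIn_of_le_triNorm`).

## References

* P. Nolin, Near-critical percolation in two dimensions, *Electron. J. Probab.* 13 (2008)
  1562–1623, §7.5, proof of Lemma 41 (item 2, (7.27)) and Lemma 42 / Prop. 43
  [arXiv 0711.4948 numbering; EJP numbers are shifted by two] [Nolin2008].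
* G. Grimmett, *Percolation*, 2nd ed. (1999), §1.5 (1.15) (`χ^f`), §6.5 [GrimmettPercolation1999].
* H. Kesten, Scaling relations for 2D-percolation, *Comm. Math. Phys.* 109 (1987), (1.16)
  [KestenScalingCMP1987].

## Mathlib / tree

Mathlib: `lintegral_tsum`, `lintegral_indicator_one`, `tsum_subtype`, `ENNReal.tsum_const_eq_top_of_ne_zero`,
`Equiv.subRight`. Tree: `triFinConn`, `mem_triOneArm_of_pathIn_of_le_triNorm`
(`NearCriticalCorrelationLength.lean`), `determinedBy_triOneArm` (`NearCriticalScaling.lean`),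
`PathIn.of_mem_siteCluster`, `pathIn_shift`, `PathIn.exists_support` (`TriRSWChaining.lean`),
`determinedBy_preimage_relabel` (`TriShiftedCrossings.lean`), `sitePercolation_real_inter_of_disjoint`,
`sitePercolation_real_preimage_relabel` (`SitePercolationMeasure.lean`),
`sitePercolatesAt_eq_iInter_exitEvent`, `measurableSet_exitEvent` (`SiteMonotonicity.lean`),
`measurableSet_siteConnIn` (`SiteConnectionTools.lean`). The identity `|S| = Σ_y 𝟙_S(y)` in `[0, ∞]`
is re-proved here (`encard_eq_tsum_indicator'`, private) to avoid importing the high-dimensional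
file `SusceptibilityGammaOne.lean` where the tree's `encard_eq_tsum_indicator` lives.
-/

noncomputable section

open MeasureTheory Set Filter Topology
open scoped ENNReal

namespace Literature.Probability.Percolation

open LatticeModels

/-! ### The connection event `{0 ↔ x}` on `𝕋` and its measurability -/

/-
The two-point event `{0 ↔ x}` of site percolation on `𝕋` ("`x` lies in the open cluster of the
origin"; Nolin 2008, §7.1, `τ_{0,x} = P_p(0 ↔ x)`) is written `{ω | x ∈ siteCluster triGraph ω 0}`
throughout (no abbreviation is introduced, so that this file stays definition-free).
-/

/-- A `G`-path of open sites from `x` to `z` puts `z` in the open cluster of `x` (local copy of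
`mem_siteCluster_of_pathIn` of `TriLadder.lean`, which is not imported here). [folklore] -/
private theorem mem_siteCluster_of_pathIn' {V : Type*} {G : SimpleGraph V} {ω : Set V} {x z : V}
    (h : PathIn G ω x z) : z ∈ siteCluster G ω x := by
  obtain ⟨hx, h⟩ := h
  refine ⟨hx, PathIn.right_mem ⟨hx, h⟩, ?_⟩
  induction h with
  | refl => exact SimpleGraph.Reachable.refl _
  | @tail b c hxb hbc ih =>
    exact ih.trans (SimpleGraph.Adj.reachable ((siteOpenGraph_adj G ω b c).2
      ⟨hbc.1, PathIn.right_mem ⟨hx, hxb⟩, hbc.2⟩))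

/-- `{0 ↔ x} = ⋃ₙ {0 ↔ x in Λ_n}`: an open path has finitely many sites, all in some hexagon
`Λ_n = triBall n`. [folklore] -/
theorem triConn_eq_iUnion (x : Site 2) :
    {ω : SiteConfig (Site 2) | x ∈ siteCluster triGraph ω 0} =
      ⋃ n : ℕ, siteConnIn triGraph ↑(triBall n) 0 x := by
  ext ω
  simp only [mem_setOf_eq, mem_iUnion]
  constructor
  · intro hx
    obtain ⟨S, hSω, hSx, -⟩ := (PathIn.of_mem_siteCluster hx).exists_support
    obtain ⟨h0, hpath⟩ := hSx
    -- a bound on `triNorm` along the path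
    suffices key : ∀ z, Relation.ReflTransGen (fun a b => triGraph.Adj a b ∧ b ∈ S) 0 z →
        ∃ n : ℕ, PathIn triGraph (↑(triBall n) ∩ ω) 0 z by
      obtain ⟨n, hn⟩ := key x hpath
      exact ⟨n, hn.mem_siteConnIn⟩
    intro z hz
    induction hz with
    | refl =>
      exact ⟨0, PathIn.refl ⟨Finset.mem_coe.2 (zero_mem_triBall 0), hSω h0⟩⟩
    | @tail b c _ hbc ih =>
      obtain ⟨n, hn⟩ := ih
      refine ⟨n + 1, (hn.mono ?_).tail hbc.1 ⟨?_, hSω hbc.2⟩⟩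
      · rintro v ⟨hv, hvω⟩
        refine ⟨Finset.mem_coe.2 (mem_triBall_iff.2 ?_), hvω⟩
        have := mem_triBall_iff.1 (Finset.mem_coe.1 hv)
        push_cast; omega
      · have hb : b ∈ (↑(triBall n) : Set (Site 2)) := hn.right_mem.1
        have hb' := mem_triBall_iff.1 (Finset.mem_coe.1 hb)
        have := triNorm_le_triNorm_add_one_of_adj hbc.1
        exact Finset.mem_coe.2 (mem_triBall_iff.2 (by push_cast; omega))
  · rintro ⟨n, hn⟩
    exact mem_siteCluster_of_pathIn' ((PathIn.of_mem_siteConnIn hn).mono inter_subset_right)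

/-- `{0 ↔ x}` is measurable. [folklore] -/
theorem measurableSet_triConn (x : Site 2) :
    MeasurableSet {ω : SiteConfig (Site 2) | x ∈ siteCluster triGraph ω 0} := by
  rw [triConn_eq_iUnion]
  exact MeasurableSet.iUnion fun n => measurableSet_siteConnIn (G := triGraph) (triBall n) 0 x

/-- `{|C(0)| = ∞}` on `𝕋` is measurable (`= ⋂ₙ {0 ↔ ∂ⁱⁿΛ_n in Λ_n}` along the hexagons,
`sitePercolatesAt_eq_iInter_exitEvent`). [folklore] -/
theorem measurableSet_sitePercolatesAt_tri :
    MeasurableSet (sitePercolatesAt triGraph (0 : Site 2)) := by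
  have hmono : Monotone triBall := fun n m hnm z hz =>
    mem_triBall_iff.2 ((mem_triBall_iff.1 hz).trans (by exact_mod_cast hnm))
  have hex : ∀ v : Site 2, ∃ n, v ∈ triBall n := fun v =>
    ⟨(triNorm v).toNat, mem_triBall_iff.2 (Int.self_le_toNat _)⟩
  rw [sitePercolatesAt_eq_iInter_exitEvent (G := triGraph) hmono hex (zero_mem_triBall 0)]
  exact MeasurableSet.iInter fun n => measurableSet_exitEvent (G := triGraph) (triBall n) 0

/-- `triFinConn 0 x = {0 ↔ x} ∩ {|C(0)| < ∞}`. [folklore] -/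
theorem triFinConn_zero_eq (x : Site 2) :
    triFinConn 0 x = {ω : SiteConfig (Site 2) | x ∈ siteCluster triGraph ω 0} ∩
      (sitePercolatesAt triGraph 0)ᶜ := by
  ext ω
  simp only [triFinConn, mem_setOf_eq, mem_inter_iff, mem_compl_iff, sitePercolatesAt,
    Set.not_infinite]

/-- `triFinConn 0 x` is measurable. [folklore] -/
theorem measurableSet_triFinConn_zero (x : Site 2) : MeasurableSet (triFinConn 0 x) := by
  rw [triFinConn_zero_eq]
  exact (measurableSet_triConn x).inter measurableSet_sitePercolatesAt_tri.compl

/-! ### `χ^f(p) = Σ_x P_p(0 ↔ x, |C(0)| < ∞)` -/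

/-- The extended cardinality of a set as a sum of indicators: `|S| = Σ_y 𝟙{y ∈ S}` in `[0, ∞]`
(a copy of the tree's `encard_eq_tsum_indicator`, `SusceptibilityGammaOne.lean`). [folklore] -/
private theorem encard_eq_tsum_indicator' {V : Type*} (S : Set V) :
    ((S.encard : ℕ∞) : ℝ≥0∞) = ∑' y, S.indicator (fun _ => (1 : ℝ≥0∞)) y := by
  classical
  rw [← tsum_subtype S (fun _ => (1 : ℝ≥0∞))]
  rcases S.finite_or_infinite with hS | hS
  · haveI : Fintype S := hS.fintype
    rw [tsum_fintype, Finset.sum_const, Finset.card_univ, nsmul_eq_mul, mul_one,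
      Set.encard_eq_coe_toFinset_card, Set.toFinset_card]
    norm_cast
  · haveI : Infinite S := hS.to_subtype
    rw [ENNReal.tsum_const_eq_top_of_ne_zero one_ne_zero, Set.encard_eq_top_iff.2 hS]
    simp

/-- **`χ^f(p) = Σ_x P_p(0 ↔ x, |C(0)| < ∞)`** for site percolation on `𝕋` (Tonelli): the
finite-cluster mean size `triMeanClusterSize p = E_p[|C(0)|; |C(0)| < ∞]` is the sum over all sites
`x` of the truncated connectivities `P_p(triFinConn 0 x)`. (Nolin 2008, §7.5, Prop. 43 with the
left-hand side of Lemma 42 at `t = 0`; Grimmett 1999, §1.5 (1.15).) [cite: Nolin2008, §7.5, Lemma 42 and Prop. 43 (arXiv 0711.4948 numbering)] -/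
theorem triMeanClusterSize_eq_tsum (p : unitInterval) :
    triMeanClusterSize p = ∑' x, triSitePercolation p (triFinConn 0 x) := by
  classical
  set F : Set (SiteConfig (Site 2)) := (sitePercolatesAt triGraph 0)ᶜ with hF
  have hind : ∀ x, F.indicator
      (fun ω : SiteConfig (Site 2) => (siteCluster triGraph ω 0).indicator (fun _ => (1 : ℝ≥0∞)) x) =
      (triFinConn 0 x).indicator 1 := by
    intro x
    funext ω
    rw [triFinConn_zero_eq]
    by_cases hω : ω ∈ F
    · rw [indicator_of_mem hω]
      by_cases hx : x ∈ siteCluster triGraph ω 0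
      · rw [indicator_of_mem hx, indicator_of_mem
          (show ω ∈ {ω : SiteConfig (Site 2) | x ∈ siteCluster triGraph ω 0} ∩ F from ⟨hx, hω⟩)]
        rfl
      · rw [indicator_of_notMem hx, indicator_of_notMem]
        exact fun h => hx h.1
    · rw [indicator_of_notMem hω, indicator_of_notMem]
      exact fun h => hω h.2
  unfold triMeanClusterSize
  have hrw : (fun ω : SiteConfig (Site 2) => F.indicator
      (fun ω => (((siteCluster triGraph ω 0).encard : ℕ∞) : ℝ≥0∞)) ω) =
      fun ω => ∑' x, F.indicator
        (fun ω => (siteCluster triGraph ω 0).indicator (fun _ => (1 : ℝ≥0∞)) x) ω := by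
    funext ω
    by_cases hω : ω ∈ F
    · simp only [indicator_of_mem hω]
      exact encard_eq_tsum_indicator' _
    · simp only [indicator_of_notMem hω, tsum_zero]
  rw [hrw, lintegral_tsum fun x => ?_]
  · refine tsum_congr fun x => ?_
    rw [hind x, lintegral_indicator_one (measurableSet_triFinConn_zero x)]
  · rw [hind x]
    exact (measurable_one.indicator (measurableSet_triFinConn_zero x)).aemeasurable

/-- The same with the truncated two-point function `τ^f_p(0, x) = P_p(triFinConn 0 x)` of
`NearCriticalCorrelationLength.lean`: `χ^f(p) = Σ_x τ^f_p(0, x)`. [cite: Nolin2008, §7.5, Prop. 43 (arXiv 0711.4948 numbering)] -/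
theorem triMeanClusterSize_eq_tsum_triTruncTwoPoint (p : unitInterval) :
    triMeanClusterSize p = ∑' x, ENNReal.ofReal (triTruncTwoPoint p 0 x) := by
  rw [triMeanClusterSize_eq_tsum]
  refine tsum_congr fun x => ?_
  rw [triTruncTwoPoint, ofReal_measureReal]

/-! ### `{0 ↔ x} ⊆ {0 ↔ ∂Λ_m}` and the arm around `x` -/

/-- `|{-x}|_𝕋 = |x|_𝕋`. [folklore] -/
private theorem triNorm_neg' (x : Site 2) : triNorm (-x) = triNorm x := by
  simp only [triNorm, Pi.neg_apply, abs_neg, ← neg_add, abs_neg]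

/-- Triangle inequality for the graph norm of `𝕋`. [folklore] -/
private theorem triNorm_add_le' (x y : Site 2) : triNorm (x + y) ≤ triNorm x + triNorm y := by
  have hx0 : |x 0| ≤ triNorm x := le_max_left _ _
  have hx1 : |x 1| ≤ triNorm x := (le_max_left _ _).trans (le_max_right _ _)
  have hx2 : |x 0 + x 1| ≤ triNorm x := (le_max_right _ _).trans (le_max_right _ _)
  have hy0 : |y 0| ≤ triNorm y := le_max_left _ _
  have hy1 : |y 1| ≤ triNorm y := (le_max_left _ _).trans (le_max_right _ _)
  have hy2 : |y 0 + y 1| ≤ triNorm y := (le_max_right _ _).trans (le_max_right _ _)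
  simp only [triNorm, Pi.add_apply]
  refine max_le ?_ (max_le ?_ ?_)
  · exact (abs_add_le _ _).trans (add_le_add hx0 hy0)
  · exact (abs_add_le _ _).trans (add_le_add hx1 hy1)
  · rw [show x 0 + y 0 + (x 1 + y 1) = (x 0 + x 1) + (y 0 + y 1) by ring]
    exact (abs_add_le _ _).trans (add_le_add hx2 hy2)

/-- **`{0 ↔ x} ⊆ {0 ↔ ∂Λ_m}` for `1 ≤ m ≤ |x|_𝕋`** (first exit of the open path through the hexagon
`Λ_m`; Nolin 2008, proof of Lemma 41, item 2). [cite: Nolin2008, §7.5, proof of Lemma 41, item 2 (arXiv 0711.4948 numbering)] -/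
theorem triConn_subset_triOneArm {x : Site 2} {m : ℕ} (hm : 1 ≤ m) (hx : (m : ℤ) ≤ triNorm x) :
    {ω : SiteConfig (Site 2) | x ∈ siteCluster triGraph ω 0} ⊆ triOneArm m := fun _ hω =>
  mem_triOneArm_of_pathIn_of_le_triNorm (PathIn.of_mem_siteCluster hω) hm hx

/-- **The arm around `x`**: on `{0 ↔ x}` with `1 ≤ m ≤ |x|_𝕋`, the translated configuration
`ω - x` has an arm `{0 ↔ ∂Λ_m}` (the open path from `x` back to `0`, translated by `-x`, runs from
`0` to `-x`, `|-x|_𝕋 = |x|_𝕋 ≥ m`). (Nolin 2008, proof of Lemma 41, item 2: the box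
`S_{2^{j-2}}(x)` around `x`.) [cite: Nolin2008, §7.5, proof of Lemma 41, item 2 (arXiv 0711.4948 numbering)] -/
theorem triConn_subset_preimage_relabel_triOneArm {x : Site 2} {m : ℕ} (hm : 1 ≤ m)
    (hx : (m : ℤ) ≤ triNorm x) :
    {ω : SiteConfig (Site 2) | x ∈ siteCluster triGraph ω 0} ⊆
      SiteConfig.relabel (Equiv.subRight x) ⁻¹' triOneArm m := by
  intro ω hω
  rw [mem_preimage, SiteConfig.relabel_apply]
  have hpath : PathIn triGraph ω x 0 := (PathIn.of_mem_siteCluster hω).symm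
  have hshift := pathIn_shift (A := ω) (B := (Equiv.subRight x) '' ω) (-x)
    (fun z hz => ⟨z, hz, by simp [sub_eq_add_neg]⟩) hpath
  simp only [add_neg_cancel, zero_add] at hshift
  refine mem_triOneArm_of_pathIn_of_le_triNorm hshift hm ?_
  rwa [triNorm_neg']

/-- The arm around `x` is determined by the sites of the translated hexagon `x + Λ_m`. [folklore] -/
theorem determinedBy_preimage_relabel_triOneArm (x : Site 2) (m : ℕ) :
    DeterminedBy (SiteConfig.relabel (Equiv.subRight x) ⁻¹' triOneArm m)
      ↑((triBall m).image fun z => z + x) := by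
  have h := determinedBy_preimage_relabel (Equiv.subRight x) (determinedBy_triOneArm m)
  convert h using 1
  rw [Finset.coe_image]
  ext z
  simp only [mem_image, Finset.mem_coe]
  constructor
  · rintro ⟨w, hw, rfl⟩; exact ⟨w, hw, rfl⟩
  · rintro ⟨w, hw, rfl⟩; exact ⟨w, hw, rfl⟩

/-- The hexagons `Λ_m` and `x + Λ_m` are disjoint when `2m < |x|_𝕋`. [folklore] -/
theorem disjoint_triBall_image_add {x : Site 2} {m : ℕ} (hx : 2 * (m : ℤ) < triNorm x) :
    Disjoint (triBall m) ((triBall m).image fun z => z + x) := by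
  rw [Finset.disjoint_left]
  intro z hz hz'
  rw [Finset.mem_image] at hz'
  obtain ⟨w, hw, rfl⟩ := hz'
  have h1 := mem_triBall_iff.1 hz
  have h2 := mem_triBall_iff.1 hw
  have h3 : triNorm x ≤ triNorm (w + x) + triNorm (-w) := by
    have := triNorm_add_le' (w + x) (-w)
    rwa [add_neg_cancel_comm] at this
  rw [triNorm_neg'] at h3
  omega

/-! ### The two-point function is at most the square of the one-arm probability -/

/-- **Two disjoint hexagons** (Nolin 2008, §7.5, proof of Lemma 41, item 2, (7.27): "since they are
disjoint, `P̂(0 ↔ x) ≤ P̂(0 ↔ ∂S(0)) P̂(x ↔ ∂S(x))`", with the hexagons `Λ_m`, `x + Λ_m` in place of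
the rhombi): for `1 ≤ m` and `2m < |x|_𝕋`,
`P_p(0 ↔ x) ≤ P_p(0 ↔ ∂Λ_m)²`, by disjoint-support independence and translation invariance of
`P_p`. Valid for every `p`. [cite: Nolin2008, §7.5, proof of Lemma 41, item 2, eq. (7.27) (arXiv 0711.4948 numbering)] -/
theorem real_triConn_le_sq (p : unitInterval) {x : Site 2} {m : ℕ} (hm : 1 ≤ m)
    (hx : 2 * (m : ℤ) < triNorm x) :
    (triSitePercolation p).real {ω | x ∈ siteCluster triGraph ω 0} ≤
      ((triSitePercolation p).real (triOneArm m)) ^ 2 := by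
  have hmx : (m : ℤ) ≤ triNorm x := by
    have := triNorm_nonneg x; omega
  set A : Set (SiteConfig (Site 2)) := triOneArm m with hA
  set B : Set (SiteConfig (Site 2)) := SiteConfig.relabel (Equiv.subRight x) ⁻¹' triOneArm m with hB
  have hsub : {ω : SiteConfig (Site 2) | x ∈ siteCluster triGraph ω 0} ⊆ A ∩ B :=
    subset_inter (triConn_subset_triOneArm hm hmx) (triConn_subset_preimage_relabel_triOneArm hm hmx)
  have hind : (triSitePercolation p).real (A ∩ B) =
      (triSitePercolation p).real A * (triSitePercolation p).real B :=
    sitePercolation_real_inter_of_disjoint p (determinedBy_triOneArm m)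
      (determinedBy_preimage_relabel_triOneArm x m) (disjoint_triBall_image_add hx)
  have hBA : (triSitePercolation p).real B = (triSitePercolation p).real A :=
    sitePercolation_real_preimage_relabel (Equiv.subRight x) p (triOneArm m)
  calc (triSitePercolation p).real {ω | x ∈ siteCluster triGraph ω 0}
      ≤ (triSitePercolation p).real (A ∩ B) := measureReal_mono hsub
    _ = ((triSitePercolation p).real A) ^ 2 := by rw [hind, hBA, sq]

/-- The truncated connectivity is at most the plain one: `P_p(triFinConn 0 x) ≤ P_p(0 ↔ x)`. [folklore] -/
theorem real_triFinConn_le_real_triConn (p : unitInterval) (x : Site 2) :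
    (triSitePercolation p).real (triFinConn 0 x) ≤
      (triSitePercolation p).real {ω | x ∈ siteCluster triGraph ω 0} := by
  rw [triFinConn_zero_eq]
  exact measureReal_mono inter_subset_left

/-- **Two disjoint hexagons, truncated form**: for `1 ≤ m` and `2m < |x|_𝕋`,
`P_p(0 ↔ x, |C(0)| < ∞) ≤ P_p(0 ↔ ∂Λ_m)²`. [cite: Nolin2008, §7.5, proof of Lemma 41, item 2, eq. (7.27), and proof of Lemma 42 (arXiv 0711.4948 numbering)] -/
theorem real_triFinConn_le_sq (p : unitInterval) {x : Site 2} {m : ℕ} (hm : 1 ≤ m)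
    (hx : 2 * (m : ℤ) < triNorm x) :
    (triSitePercolation p).real (triFinConn 0 x) ≤ ((triSitePercolation p).real (triOneArm m)) ^ 2 :=
  (real_triFinConn_le_real_triConn p x).trans (real_triConn_le_sq p hm hx)

/-- **Far sites and the rhombus arm**: if some coordinate of `x` has absolute value `≥ n ≥ 1`, then
`{0 ↔ x, |C(0)| < ∞} ⊆ {0 ↝ ∂S_n} ∩ {|C(0)| < ∞}` (`triBoxArm n`, the event of the radius decay
`Nolin2008_radius_decay_at`; Nolin 2008, proof of Lemma 42, the far rhombi). [cite: Nolin2008, §7.5, proof of Lemma 42 (arXiv 0711.4948 numbering)] -/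
theorem triFinConn_subset_triBoxArm_inter {x : Site 2} {n : ℕ} (hn : 1 ≤ n)
    (hx : ∃ i, (n : ℤ) ≤ |x i|) :
    triFinConn 0 x ⊆ triBoxArm n ∩ (sitePercolatesAt triGraph 0)ᶜ := by
  intro ω hω
  have hω' := hω
  rw [triFinConn_zero_eq] at hω'
  exact ⟨mem_triBoxArm_of_pathIn (PathIn.of_mem_siteCluster hω.1) hn hx, hω'.2⟩

/-- If `2n ≤ |x|_𝕋` then some coordinate of `x` has absolute value `≥ n`
(`|x|_𝕋 = max(|x₀|, |x₁|, |x₀ + x₁|) ≤ 2 max(|x₀|, |x₁|)`). [folklore] -/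
theorem exists_le_abs_apply_of_le_triNorm {x : Site 2} {n : ℕ} (hx : 2 * (n : ℤ) ≤ triNorm x) :
    ∃ i, (n : ℤ) ≤ |x i| := by
  by_contra h
  push Not at h
  have h0 := h 0
  have h1 := h 1
  have : triNorm x < 2 * n := by
    simp only [triNorm, max_lt_iff]
    refine ⟨by omega, by omega, ?_⟩
    exact (abs_add_le _ _).trans_lt (by omega)
  omega

end Literature.Probability.Percolation
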